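import Summits.QuantumAdvantage.QuantumAdvantage.Theorems.WbwObfuscatedGluedTrees.Negative.LoadBearing
import Literature.Computability.Complexity.RandomizedProofs

/-!
# Stub `stub_transport` — clause (C) is transported along eventual agreement of generators and shrinking of the
# success event  (crux `WbwObfuscatedGluedTrees`, stmt-QuantumAdvantage-2340; line `knowledge-of-walk-split`, stage 2)

If two generator/answer pairs `(gen, ans)`, `(gen', ans')` satisfy `gen s = gen' s` and
`{y | ans s <+: y} ⊆ {y | ans' s <+: y}` for all seeds of length `≥ n₀`, then `ClauseC gen' ans' → ClauseC gen ans`: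
for `n ≥ n₀` the level-`n` success average of any PPT adversary against `(gen, ans)` is at most the one against
`(gen', ans')` (same instance, smaller event — `RandAlg.pr` is monotone in the event, `uniformAvg` in the integrand,
and the seeds averaged at level `n` all have length `n`), and a nonnegative sequence eventually dominated by a
superpolynomially decaying one decays superpolynomially (`Asymptotics.SuperpolynomialDecay.trans_eventually_abs_le`).
[folklore]
-/

set_option linter.dupNamespace false

namespace Summit.QuantumAdvantage.QuantumAdvantage.Theorems.WbwObfuscatedGluedTrees.KnowledgeOfWalk.Generator

open Literature.Computability.Cryptography Literature.Computability.Complexity Filter Asymptotics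
open Summit.QuantumAdvantage.QuantumAdvantage.Theorems.WbwObfuscatedGluedTrees.Negative (ClauseC)

/-- **Transport of clause (C)** along eventual agreement of the generators and containment of the success
events: fix a PPT `A`; for `n ≥ n₀` every seed `s` of length `n` has `gen s = gen' s` and a smaller success event,
so termwise `A.pr … ≤ A.pr …` (monotonicity of the outer measure of the output `PMF`, which is finite), hence the
level-`n` averages compare (`Finset.sum_le_sum`); both averages are nonnegative, and
`SuperpolynomialDecay.trans_eventually_abs_le` concludes. [folklore] -/
theorem stub_transport :
    ∀ (gen gen' ans ans' : List Bool → List Bool),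
      (∃ n₀ : ℕ, ∀ s : List Bool, n₀ ≤ s.length → gen s = gen' s ∧ {y | ans s <+: y} ⊆ {y | ans' s <+: y}) →
      ClauseC gen' ans' → ClauseC gen ans := by
  intro gen gen' ans ans' hagree hC A hA
  obtain ⟨n₀, hn₀⟩ := hagree
  refine (hC A hA).trans_eventually_abs_le ?_
  rw [Filter.EventuallyLE, Filter.eventually_atTop]
  refine ⟨n₀, fun n hn => ?_⟩
  have h0 : 0 ≤ uniformAvg n fun s =>
      A.pr id (boolPair (Computability.unaryEncodeNat n) (gen s)) {y | ans s <+: y} :=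
    uniformAvg_nonneg fun _ => RandAlg.pr_nonneg _ _ _ _
  have h0' : 0 ≤ uniformAvg n fun s =>
      A.pr id (boolPair (Computability.unaryEncodeNat n) (gen' s)) {y | ans' s <+: y} :=
    uniformAvg_nonneg fun _ => RandAlg.pr_nonneg _ _ _ _
  simp only [Function.comp_apply]
  rw [abs_of_nonneg h0, abs_of_nonneg h0']
  -- monotonicity of the uniform average in the integrand, on seeds of length `n ≥ n₀`
  unfold uniformAvg
  refine div_le_div_of_nonneg_right (Finset.sum_le_sum fun s _ => ?_) (by positivity)
  obtain ⟨hg, hsub⟩ := hn₀ s.toList (by simpa using hn)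
  dsimp only
  rw [hg]
  -- monotonicity of `RandAlg.pr` in the event
  unfold RandAlg.pr
  refine ENNReal.toReal_mono (ne_top_of_le_ne_top ENNReal.one_ne_top ?_)
    ((A.outputPMF id _).toOuterMeasure.mono hsub)
  exact ((A.outputPMF id _).toOuterMeasure.mono (Set.subset_univ _)).trans_eq
    ((PMF.toOuterMeasure_apply_eq_one_iff _ _).2 (Set.subset_univ _))

end Summit.QuantumAdvantage.QuantumAdvantage.Theorems.WbwObfuscatedGluedTrees.KnowledgeOfWalk.Generator
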